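import Literature.Barriers.ValiantsHypothesis.FullRankMultilinear
import Mathlib.Algebra.MvPolynomial.Supported
import HarnessLib

/-!
# The Raz–Yehudayoff polynomials with specialised coefficients, and balanced intervals
(tools for Raz–Yehudayoff 2008, Lemma 4.3)

Support file for the proof of `Literature.Barriers.ValiantsHypothesis.RazYehudayoff2008_thm42`
(`FullRankMultilinearProofs.lean`).

* `ryFc S N c` — the family `f_{i,j}` of [RazYehudayoff2008, §4.1] with the auxiliary variable
  `ω_{i,ℓ,j}` replaced by an arbitrary coefficient `c i ℓ j ∈ S` (same recursion, same fuel
  convention as the tree's `ryF`): `f_{[i, i+len)} = (1 + x_i x_{i+len-1}) f_{[i+1, i+len-1)} +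
  ∑_a c_{i, i+a-1, i+len-1} f_{[i, i+a)} f_{[i+a, i+len)}` over even `2 ≤ a ≤ len - 2`. The vendored
  polynomial over `K = F(W)` is the member `c = ω` (`toRYField_ryF`), ring maps act on `c`
  (`map_ryFc`), the value is stable in the fuel (`ryFc_stable`), depends on `c` only through the
  sub-intervals (`ryFc_congr`), and involves only the variables of its interval
  (`ryFc_mem_supported`, eq. (4.1) of the source).
* Balanced intervals [RazYehudayoff2008, §4.3]: for a colouring `col` of the positions
  (`true` = "`A(x_k) ∈ Y`"), `YI`, `ZI` are the `Y`- and `Z`-positions of the interval `[i, i+len)`,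
  `Dd` is `D_{i,j}(A) = |Y ∩ [i,j]| - |Z ∩ [i,j]|`, and `caseOne` is the sign argument of Case one
  of the proof of Lemma 4.3 ("for all `ℓ ∈ [i+1, j-1]`, `D_{i,ℓ}(A) > 0`, hence `D_{j,j} = -1` and
  `[i+1, j-1]` is balanced").

## References
* [RazYehudayoff2008] R. Raz, A. Yehudayoff, *Balancing syntactically multilinear arithmetic
  circuits*, Comput. Complexity 17 (2008) 515–535, §4.1, §4.3, §4.3.1.
-/

noncomputable section

namespace Literature.Barriers.ValiantsHypothesis.RazYehudayoff

open MvPolynomial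

/-! ### The family with specialised coefficients -/

section Family

variable (S : Type*) [CommSemiring S] (N : ℕ)

/-- `x_k ∈ S[x_0, …, x_{N-1}]` (zero for `k ≥ N`, as the tree's `ryX`). [cite: RazYehudayoff2008, §4.1] -/
def xv (k : ℕ) : MvPolynomial (Fin N) S :=
  if h : k < N then X ⟨k, h⟩ else 0

/-- **The Raz–Yehudayoff polynomials with coefficients `c`**: `ryFc S N c fuel len i` is
`f_{[i, i+len)}` computed by the printed recursion with `c i ℓ j` in place of `ω_{i,ℓ,j}`
(first argument = recursion fuel, any value `≥ len / 2` gives the polynomial; cf. `ryF`).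
[cite: RazYehudayoff2008, §4.1] -/
def ryFc (c : ℕ → ℕ → ℕ → S) : ℕ → ℕ → ℕ → MvPolynomial (Fin N) S
  | 0, _, _ => 1
  | fuel + 1, len, i =>
    if len = 0 then 1 else
      (1 + xv S N i * xv S N (i + len - 1)) * ryFc c fuel (len - 2) (i + 1) +
        ∑ a ∈ (Finset.range (len - 1)).filter (fun a => Even a ∧ 2 ≤ a),
          C (c i (i + a - 1) (i + len - 1)) * ryFc c fuel a i * ryFc c fuel (len - a) (i + a)

variable {S N}

/-- Length `0` gives `1` (any fuel). [cite: RazYehudayoff2008, §4.1] -/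
@[simp] theorem ryFc_len_zero (c : ℕ → ℕ → ℕ → S) (fuel i : ℕ) : ryFc S N c fuel 0 i = 1 := by
  cases fuel <;> simp [ryFc]

/-- The recursion step. [cite: RazYehudayoff2008, §4.1] -/
theorem ryFc_succ (c : ℕ → ℕ → ℕ → S) {len : ℕ} (h : len ≠ 0) (fuel i : ℕ) :
    ryFc S N c (fuel + 1) len i =
      (1 + xv S N i * xv S N (i + len - 1)) * ryFc S N c fuel (len - 2) (i + 1) +
        ∑ a ∈ (Finset.range (len - 1)).filter (fun a => Even a ∧ 2 ≤ a),
          C (c i (i + a - 1) (i + len - 1)) * ryFc S N c fuel a i *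
            ryFc S N c fuel (len - a) (i + a) := by
  rw [ryFc, if_neg h]

/-- In range, `xv` is the variable. [folklore] -/
theorem xv_of_lt {k : ℕ} (h : k < N) : xv S N k = X ⟨k, h⟩ := dif_pos h

/-- Ring maps on the coefficients fix the variables. [folklore] -/
theorem map_xv {S' : Type*} [CommSemiring S'] (φ : S →+* S') (k : ℕ) :
    MvPolynomial.map φ (xv S N k) = xv S' N k := by
  unfold xv
  split_ifs <;> simp

/-- **Ring maps act on the coefficients**: `φ_* f^{c} = f^{φ ∘ c}`. [folklore] -/
theorem map_ryFc {S' : Type*} [CommSemiring S'] (φ : S →+* S') (c : ℕ → ℕ → ℕ → S)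
    (fuel len i : ℕ) :
    MvPolynomial.map φ (ryFc S N c fuel len i) =
      ryFc S' N (fun i l j => φ (c i l j)) fuel len i := by
  induction fuel generalizing len i with
  | zero => simp [ryFc]
  | succ fuel ih =>
    by_cases h : len = 0
    · subst h
      simp
    · rw [ryFc_succ c h, ryFc_succ _ h]
      simp [map_add, map_mul, map_sum, map_xv, ih]

/-- **Stability in the fuel**: any fuel `≥ len / 2` computes the same polynomial. [folklore] -/
theorem ryFc_stable (c : ℕ → ℕ → ℕ → S) {fuel fuel' len : ℕ} (h : len ≤ 2 * fuel)
    (h' : len ≤ 2 * fuel') (i : ℕ) : ryFc S N c fuel len i = ryFc S N c fuel' len i := by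
  induction fuel generalizing fuel' len i with
  | zero =>
    obtain rfl : len = 0 := by omega
    simp
  | succ fuel ih =>
    by_cases hlen : len = 0
    · subst hlen
      simp
    · obtain ⟨f', rfl⟩ : ∃ f', fuel' = f' + 1 := ⟨fuel' - 1, by omega⟩
      rw [ryFc_succ c hlen, ryFc_succ c hlen,
        ih (fuel' := f') (len := len - 2) (i := i + 1) (by omega) (by omega)]
      congr 1
      refine Finset.sum_congr rfl fun a ha => ?_
      simp only [Finset.mem_filter, Finset.mem_range] at ha
      rw [ih (fuel' := f') (len := a) (i := i) (by omega) (by omega),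
        ih (fuel' := f') (len := len - a) (i := i + a) (by omega) (by omega)]

/-- **Locality in the coefficients**: `f^{c}_{[i, i+len)}` only depends on the coefficients
`c i' ℓ j'` with `i ≤ i' ≤ ℓ ≤ j' < i + len`. [cite: RazYehudayoff2008, §4.1 (eq. (4.1))] -/
theorem ryFc_congr {c c' : ℕ → ℕ → ℕ → S} {len i : ℕ}
    (h : ∀ i' l j', i ≤ i' → i' ≤ l → l ≤ j' → j' < i + len → c i' l j' = c' i' l j')
    (fuel : ℕ) : ryFc S N c fuel len i = ryFc S N c' fuel len i := by
  induction fuel generalizing len i with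
  | zero => simp [ryFc]
  | succ fuel ih =>
    by_cases hlen : len = 0
    · subst hlen
      simp
    · rw [ryFc_succ c hlen, ryFc_succ c' hlen,
        ih (len := len - 2) (i := i + 1) (fun i' l j' h1 h2 h3 h4 => h i' l j' (by omega) h2 h3
          (by omega))]
      congr 1
      refine Finset.sum_congr rfl fun a ha => ?_
      simp only [Finset.mem_filter, Finset.mem_range] at ha
      rw [h i (i + a - 1) (i + len - 1) le_rfl (by omega) (by omega) (by omega),
        ih (len := a) (i := i) (fun i' l j' h1 h2 h3 h4 => h i' l j' h1 h2 h3 (by omega)),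
        ih (len := len - a) (i := i + a) (fun i' l j' h1 h2 h3 h4 => h i' l j' (by omega) h2 h3
          (by omega))]

/-! ### Variables occurring in `f_{i,j}` (eq. (4.1)) -/

variable (N) in
/-- The positions of the interval `[i, i + len)` (as elements of `Fin N`). [cite: RazYehudayoff2008, §4.1 (`X_{i,j}`)] -/
def Iv (i len : ℕ) : Finset (Fin N) :=
  Finset.univ.filter (fun k => i ≤ k.1 ∧ k.1 < i + len)

/-- Membership in `Iv`. [folklore] -/
@[simp] theorem mem_Iv {i len : ℕ} {k : Fin N} : k ∈ Iv N i len ↔ i ≤ k.1 ∧ k.1 < i + len := by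
  simp [Iv]

/-- Sub-intervals. [folklore] -/
theorem Iv_subset {i len i' len' : ℕ} (h1 : i ≤ i') (h2 : i' + len' ≤ i + len) :
    Iv N i' len' ⊆ Iv N i len := by
  intro k hk
  rw [mem_Iv] at hk ⊢
  omega

/-- Disjoint intervals. [folklore] -/
theorem Iv_disjoint {i a j b : ℕ} (h : i + a ≤ j) : Disjoint (Iv N i a) (Iv N j b) := by
  rw [Finset.disjoint_left]
  intro k hk hk'
  rw [mem_Iv] at hk hk'
  omega

/-- Splitting an interval. [folklore] -/
theorem Iv_split {i len a : ℕ} (ha : a ≤ len) : Iv N i len = Iv N i a ∪ Iv N (i + a) (len - a) := by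
  ext k
  simp only [mem_Iv, Finset.mem_union]
  omega

/-- The empty interval. [folklore] -/
@[simp] theorem Iv_zero (i : ℕ) : Iv N i 0 = ∅ := by
  ext k
  simp

/-- A one-point interval. [folklore] -/
theorem Iv_one {i : ℕ} (h : i < N) : Iv N i 1 = {⟨i, h⟩} := by
  ext k
  simp only [mem_Iv, Finset.mem_singleton, Fin.ext_iff]
  omega

/-- The variable `x_k` only involves position `k`. [folklore] -/
theorem xv_mem_supported {k : ℕ} (W : Finset (Fin N)) (h : ∀ hk : k < N, (⟨k, hk⟩ : Fin N) ∈ W) :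
    xv S N k ∈ supported S (↑W : Set (Fin N)) := by
  unfold xv
  split_ifs with hk
  · rw [supported_eq_adjoin_X]
    exact Algebra.subset_adjoin (Set.mem_image_of_mem X (Finset.mem_coe.2 (h hk)))
  · exact Subalgebra.zero_mem _

/-- Constants involve no variables. [folklore] -/
theorem C_mem_supported (r : S) (W : Finset (Fin N)) :
    (C r : MvPolynomial (Fin N) S) ∈ supported S (↑W : Set (Fin N)) := by
  rw [← MvPolynomial.algebraMap_eq]
  exact Subalgebra.algebraMap_mem _ r

/-- **Eq. (4.1) of the source**: `f_{[i, i+len)}` only involves the variables `x_k`,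
`k ∈ [i, i+len)` (the `ω`'s being coefficients here). [cite: RazYehudayoff2008, §4.1 (eq. (4.1))] -/
theorem ryFc_mem_supported (c : ℕ → ℕ → ℕ → S) (fuel len i : ℕ) :
    ryFc S N c fuel len i ∈ supported S (↑(Iv N i len) : Set (Fin N)) := by
  induction fuel generalizing len i with
  | zero =>
    simp only [ryFc]
    exact Subalgebra.one_mem _
  | succ fuel ih =>
    by_cases hlen : len = 0
    · subst hlen
      simp only [ryFc_len_zero]
      exact Subalgebra.one_mem _
    · rw [ryFc_succ c hlen]
      refine Subalgebra.add_mem _ (Subalgebra.mul_mem _ (Subalgebra.add_mem _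
        (Subalgebra.one_mem _) (Subalgebra.mul_mem _ (xv_mem_supported _ fun hk => ?_)
          (xv_mem_supported _ fun hk => ?_)))
        (supported_mono (Finset.coe_subset.2 (Iv_subset (by omega) (by omega))) (ih _ _)))
        (Subalgebra.sum_mem _ fun a ha => ?_)
      · simp only [mem_Iv]
        omega
      · simp only [mem_Iv]
        omega
      · simp only [Finset.mem_filter, Finset.mem_range] at ha
        exact Subalgebra.mul_mem _ (Subalgebra.mul_mem _ (C_mem_supported _ _)
          (supported_mono (Finset.coe_subset.2 (Iv_subset le_rfl (by omega))) (ih _ _)))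
          (supported_mono (Finset.coe_subset.2 (Iv_subset (by omega) (by omega))) (ih _ _))

end Family

/-! ### The vendored polynomial is the member `c = ω` of the family -/

section Vendored

universe u

variable (F : Type u) [Field F]

/-- `ω_{i,ℓ,j} ∈ F[W]` (zero outside the index range, as the tree's `ryW`). [cite: RazYehudayoff2008, §4.1] -/
def wPoly (N : ℕ) (i l j : ℕ) : MvPolynomial (RYAux N) F :=
  if h : i < N ∧ l < N ∧ j < N then X (⟨i, h.1⟩, ⟨l, h.2.1⟩, ⟨j, h.2.2⟩) else 0

/-- `toRYField` on the variables `x_i`. [folklore] -/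
theorem toRYField_ryX (n i : ℕ) :
    toRYField F n (ryX F (2 * n) i) = xv (RYField F n) (2 * n) i := by
  unfold ryX xv
  split_ifs with h <;> simp [toRYField, sumAlgEquiv_X_inl]

/-- `toRYField` on the variables `ω_{i,ℓ,j}`: they become constants of `K = F(W)`. [folklore] -/
theorem toRYField_ryW (n i l j : ℕ) :
    toRYField F n (ryW F (2 * n) i l j) =
      C (algebraMap (MvPolynomial (RYAux (2 * n)) F) (RYField F n) (wPoly F (2 * n) i l j)) := by
  unfold ryW wPoly
  split_ifs with h <;> simp [toRYField, sumAlgEquiv_X_inr]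

/-- **The vendored polynomial over `K = F(W)` is `f^{c}` with `c = ω`** (as constants of `K`).
[cite: RazYehudayoff2008, §4.1 and Thm. 4.2] -/
theorem toRYField_ryF (n fuel len i : ℕ) :
    toRYField F n (ryF F (2 * n) fuel len i) =
      ryFc (RYField F n) (2 * n)
        (fun i l j => algebraMap (MvPolynomial (RYAux (2 * n)) F) (RYField F n)
          (wPoly F (2 * n) i l j)) fuel len i := by
  induction fuel generalizing len i with
  | zero => simp [ryF, ryFc]
  | succ fuel ih =>
    by_cases h : len = 0
    · subst h
      simp [ryF]
    · rw [ryF, if_neg h, ryFc_succ _ h]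
      simp only [map_add, map_mul, map_one, map_sum, toRYField_ryX, toRYField_ryW, ih]

/-- In particular for `f = f_{1,2n}`. [cite: RazYehudayoff2008, §4.1 and Thm. 4.2] -/
theorem razYehudayoffPolyK_eq (n : ℕ) :
    razYehudayoffPolyK F n =
      MvPolynomial.map (algebraMap (MvPolynomial (RYAux (2 * n)) F) (RYField F n))
        (ryFc (MvPolynomial (RYAux (2 * n)) F) (2 * n) (wPoly F (2 * n)) (n + 1) (2 * n) 0) := by
  rw [map_ryFc]
  exact toRYField_ryF F n (n + 1) (2 * n) 0

end Vendored

/-! ### Balanced intervals (§4.3) -/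

section Balanced

variable {N : ℕ} (col : Fin N → Bool)

/-- The `Y`-positions of `[i, i+len)` ("`A(X_{i,j}) ∩ Y`"). [cite: RazYehudayoff2008, §4.3] -/
def YI (i len : ℕ) : Finset (Fin N) := (Iv N i len).filter (fun k => col k = true)

/-- The `Z`-positions of `[i, i+len)` ("`A(X_{i,j}) ∩ Z`"). [cite: RazYehudayoff2008, §4.3] -/
def ZI (i len : ℕ) : Finset (Fin N) := (Iv N i len).filter (fun k => col k = false)

/-- `D_{i,j}(A) = |A(X_{i,j}) ∩ Y| - |A(X_{i,j}) ∩ Z|`; the interval is *balanced* when it is `0`.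
[cite: RazYehudayoff2008, §4.3] -/
def Dd (i len : ℕ) : ℤ := ((YI col i len).card : ℤ) - (ZI col i len).card

/-- `D_{k,k}(A) = ±1` according to the side of `A(x_k)`. [cite: RazYehudayoff2008, §4.3.1] -/
def sgn (k : Fin N) : ℤ := if col k = true then 1 else -1

/-- Membership in `YI`. [folklore] -/
@[simp] theorem mem_YI {i len : ℕ} {k : Fin N} :
    k ∈ YI col i len ↔ (i ≤ k.1 ∧ k.1 < i + len) ∧ col k = true := by
  simp [YI]

/-- Membership in `ZI`. [folklore] -/
@[simp] theorem mem_ZI {i len : ℕ} {k : Fin N} :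
    k ∈ ZI col i len ↔ (i ≤ k.1 ∧ k.1 < i + len) ∧ col k = false := by
  simp [ZI]

/-- `YI ⊆ Iv`. [folklore] -/
theorem YI_subset_Iv (i len : ℕ) : YI col i len ⊆ Iv N i len := Finset.filter_subset _ _

/-- `ZI ⊆ Iv`. [folklore] -/
theorem ZI_subset_Iv (i len : ℕ) : ZI col i len ⊆ Iv N i len := Finset.filter_subset _ _

/-- Splitting the `Y`-positions of an interval. [folklore] -/
theorem YI_split {i len a : ℕ} (ha : a ≤ len) :
    YI col i len = YI col i a ∪ YI col (i + a) (len - a) := by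
  rw [YI, Iv_split ha, Finset.filter_union]
  rfl

/-- Splitting the `Z`-positions of an interval. [folklore] -/
theorem ZI_split {i len a : ℕ} (ha : a ≤ len) :
    ZI col i len = ZI col i a ∪ ZI col (i + a) (len - a) := by
  rw [ZI, Iv_split ha, Finset.filter_union]
  rfl

/-- `D` is additive over a split ("`D_{ℓ₀+1,j}(A) = D_{i,j}(A) - D_{i,ℓ₀}(A)`").
[cite: RazYehudayoff2008, §4.3.1 (Case two)] -/
theorem Dd_split {i len a : ℕ} (ha : a ≤ len) :
    Dd col i len = Dd col i a + Dd col (i + a) (len - a) := by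
  have hdisj : Disjoint (Iv N i a) (Iv N (i + a) (len - a)) := Iv_disjoint le_rfl
  simp only [Dd, YI, ZI]
  rw [Iv_split ha, Finset.filter_union, Finset.filter_union,
    Finset.card_union_of_disjoint (Finset.disjoint_filter_filter hdisj),
    Finset.card_union_of_disjoint (Finset.disjoint_filter_filter hdisj)]
  push_cast
  ring

/-- The empty interval is balanced. [folklore] -/
@[simp] theorem Dd_zero (i : ℕ) : Dd col i 0 = 0 := by
  simp [Dd, YI, ZI]

/-- `YI` of the empty interval. [folklore] -/
@[simp] theorem YI_zero (i : ℕ) : YI col i 0 = ∅ := by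
  simp [YI]

/-- `ZI` of the empty interval. [folklore] -/
@[simp] theorem ZI_zero (i : ℕ) : ZI col i 0 = ∅ := by
  simp [ZI]

/-- `YI` of a point. [folklore] -/
theorem YI_one {i : ℕ} (h : i < N) :
    YI col i 1 = if col ⟨i, h⟩ = true then {⟨i, h⟩} else ∅ := by
  simp only [YI]
  rw [Iv_one h, Finset.filter_singleton]

/-- `ZI` of a point. [folklore] -/
theorem ZI_one {i : ℕ} (h : i < N) :
    ZI col i 1 = if col ⟨i, h⟩ = false then {⟨i, h⟩} else ∅ := by
  simp only [ZI]
  rw [Iv_one h, Finset.filter_singleton]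

/-- `YI` of a `Y`-point. [folklore] -/
theorem YI_one_of_eq_true {i : ℕ} (h : i < N) (hc : col ⟨i, h⟩ = true) :
    YI col i 1 = {⟨i, h⟩} := by
  rw [YI_one col h, if_pos hc]

/-- `YI` of a `Z`-point. [folklore] -/
theorem YI_one_of_eq_false {i : ℕ} (h : i < N) (hc : col ⟨i, h⟩ = false) : YI col i 1 = ∅ := by
  rw [YI_one col h, if_neg (by simp [hc])]

/-- `ZI` of a `Y`-point. [folklore] -/
theorem ZI_one_of_eq_true {i : ℕ} (h : i < N) (hc : col ⟨i, h⟩ = true) : ZI col i 1 = ∅ := by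
  rw [ZI_one col h, if_neg (by simp [hc])]

/-- `ZI` of a `Z`-point. [folklore] -/
theorem ZI_one_of_eq_false {i : ℕ} (h : i < N) (hc : col ⟨i, h⟩ = false) :
    ZI col i 1 = {⟨i, h⟩} := by
  rw [ZI_one col h, if_pos hc]

/-- End points and inner part: `Y ∩ [i, j] = (Y ∩ {i, j}) ∪ (Y ∩ [i+1, j-1])`. [folklore] -/
theorem YI_ends {i len : ℕ} (h : 2 ≤ len) :
    YI col i len = (YI col i 1 ∪ YI col (i + len - 1) 1) ∪ YI col (i + 1) (len - 2) := by
  rw [YI_split col (show 1 ≤ len by omega),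
    YI_split col (i := i + 1) (len := len - 1) (a := len - 2) (by omega),
    show i + 1 + (len - 2) = i + len - 1 by omega, show len - 1 - (len - 2) = 1 by omega,
    Finset.union_assoc, Finset.union_comm (YI col (i + len - 1) 1)]

/-- End points and inner part: `Z ∩ [i, j] = (Z ∩ {i, j}) ∪ (Z ∩ [i+1, j-1])`. [folklore] -/
theorem ZI_ends {i len : ℕ} (h : 2 ≤ len) :
    ZI col i len = (ZI col i 1 ∪ ZI col (i + len - 1) 1) ∪ ZI col (i + 1) (len - 2) := by
  rw [ZI_split col (show 1 ≤ len by omega),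
    ZI_split col (i := i + 1) (len := len - 1) (a := len - 2) (by omega),
    show i + 1 + (len - 2) = i + len - 1 by omega, show len - 1 - (len - 2) = 1 by omega,
    Finset.union_assoc, Finset.union_comm (ZI col (i + len - 1) 1)]

/-- `D_{k,k}(A) = ±1`. [cite: RazYehudayoff2008, §4.3.1] -/
theorem Dd_one {i : ℕ} (h : i < N) : Dd col i 1 = sgn col ⟨i, h⟩ := by
  simp only [Dd, sgn]
  rw [YI_one col h, ZI_one col h]
  cases col ⟨i, h⟩ <;> simp

/-- `sgn = ±1`. [folklore] -/
theorem sgn_eq_or (k : Fin N) : sgn col k = 1 ∨ sgn col k = -1 := by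
  unfold sgn
  split_ifs <;> simp

/-- A balanced interval has as many `Y`- as `Z`-positions. [cite: RazYehudayoff2008, §4.3] -/
theorem card_YI_eq_card_ZI {i len : ℕ} (h : Dd col i len = 0) :
    (YI col i len).card = (ZI col i len).card := by
  unfold Dd at h
  omega

/-- One more point on the right: `D_{[i, i+t+1)} = D_{[i, i+t)} + D_{i+t, i+t}`. [cite: RazYehudayoff2008, §4.3.1] -/
theorem Dd_succ {i t : ℕ} (h : i + t < N) :
    Dd col i (t + 1) = Dd col i t + sgn col ⟨i + t, h⟩ := by
  rw [Dd_split col (Nat.le_add_right t 1), Nat.add_sub_cancel_left, Dd_one col h]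

/-- Parity: `D_{[i, i+t)} ≡ t (mod 2)` ("if an interval is balanced on `A`, then the interval is
of even length"). [cite: RazYehudayoff2008, §4.3.1] -/
theorem even_Dd_sub {i : ℕ} (t : ℕ) (ht : i + t ≤ N) : Even (Dd col i t - t) := by
  induction t with
  | zero => simp
  | succ t ih =>
    have hlt : i + t < N := by omega
    rw [Dd_succ col hlt]
    have hre : Dd col i t + sgn col ⟨i + t, hlt⟩ - ((t + 1 : ℕ) : ℤ) =
        (Dd col i t - t) + (sgn col ⟨i + t, hlt⟩ - 1) := by
      push_cast
      ring
    rw [hre]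
    refine (ih hlt.le).add ?_
    rcases sgn_eq_or col ⟨i + t, hlt⟩ with h | h <;> rw [h]
    · exact ⟨0, by norm_num⟩
    · exact ⟨-1, by norm_num⟩

/-- **Case one of [RazYehudayoff2008, Lemma 4.3] (the sign argument).** If `[i, i+len)` is
balanced (`len ≥ 2` even) and no proper even-length prefix `[i, i+a)`, `2 ≤ a ≤ len - 2`, is
balanced, then the two end points lie on different sides of the partition ("`D_{i,i} = 1` and
`D_{j,j} = -1`") and the inner interval `[i+1, i+len-1)` is balanced. [cite: RazYehudayoff2008, §4.3.1 (Case one)] -/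
theorem caseOne {i len : ℕ} (hlen : 2 ≤ len) (heven : Even len) (hN : i + len ≤ N)
    (hbal : Dd col i len = 0)
    (hno : ∀ a, 2 ≤ a → a + 2 ≤ len → Even a → Dd col i a ≠ 0) :
    col ⟨i, by omega⟩ ≠ col ⟨i + len - 1, by omega⟩ ∧ Dd col (i + 1) (len - 2) = 0 := by
  have hi : i < N := by omega
  have hj : i + len - 1 < N := by omega
  -- "for all `ℓ ∈ [i+1, j-1]`, `D_{i,ℓ}(A) > 0`" (in the orientation of `D_{i,i}`)
  have claim : ∀ t, 1 ≤ t → t + 1 ≤ len → 1 ≤ Dd col i t * sgn col ⟨i, hi⟩ := by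
    intro t
    induction t with
    | zero => intro h; omega
    | succ t ih =>
      intro _ ht
      have hit : i + t < N := by omega
      rcases Nat.eq_zero_or_pos t with rfl | htpos
      · rw [zero_add, Dd_one col hi]
        rcases sgn_eq_or col ⟨i, hi⟩ with h | h <;> rw [h] <;> norm_num
      · have ih' := ih htpos (by omega)
        rw [Dd_succ col hit]
        by_cases hpar : Even (t + 1)
        · have ht2 : t + 1 + 2 ≤ len := by
            obtain ⟨r, hr⟩ := heven
            obtain ⟨q, hq⟩ := hpar
            omega
          have hne : Dd col i (t + 1) ≠ 0 := hno (t + 1) (by omega) ht2 hpar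
          rw [Dd_succ col hit] at hne
          rcases sgn_eq_or col ⟨i, hi⟩ with h | h <;>
            rcases sgn_eq_or col ⟨i + t, hit⟩ with h' | h' <;>
              rw [h'] at hne ⊢ <;> rw [h] at ih' ⊢ <;> omega
        · have ht : Even t := by
            by_contra h
            exact hpar (Nat.even_add_one.2 h)
          have hD : Even (Dd col i t) := by
            have h1 := even_Dd_sub col t hit.le
            have h2 : Even (t : ℤ) := (Int.even_coe_nat t).2 ht
            exact (Int.even_sub.1 h1).2 h2
          obtain ⟨r, hr⟩ := hD
          rcases sgn_eq_or col ⟨i, hi⟩ with h | h <;>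
            rcases sgn_eq_or col ⟨i + t, hit⟩ with h' | h' <;>
              rw [h'] <;> rw [h] at ih' ⊢ <;> omega
  have hlast := claim (len - 1) (by omega) (by omega)
  have hil : i + (len - 1) < N := by omega
  have hsplit : Dd col i len = Dd col i (len - 1) + sgn col ⟨i + (len - 1), hil⟩ := by
    have := Dd_succ col (t := len - 1) hil
    rwa [Nat.sub_add_cancel (by omega : 1 ≤ len)] at this
  have hfin : (⟨i + (len - 1), hil⟩ : Fin N) = ⟨i + len - 1, hj⟩ :=
    Fin.ext (by show i + (len - 1) = i + len - 1; omega)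
  rw [hfin] at hsplit
  -- "`D_{j,j}(A) = -D_{i,i}(A)`"
  have hopp : sgn col ⟨i + len - 1, hj⟩ = -sgn col ⟨i, hi⟩ := by
    rcases sgn_eq_or col ⟨i, hi⟩ with h | h <;>
      rcases sgn_eq_or col ⟨i + len - 1, hj⟩ with h' | h' <;>
        rw [h] at hlast ⊢ <;> rw [h'] at hsplit ⊢ <;> omega
  constructor
  · intro heq
    have hsame : sgn col ⟨i + len - 1, hj⟩ = sgn col ⟨i, hi⟩ := by
      unfold sgn
      rw [heq]
    rw [hsame] at hopp
    rcases sgn_eq_or col ⟨i, hi⟩ with h | h <;> rw [h] at hopp <;> omega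
  · have h1 : Dd col i len = Dd col i 1 + Dd col (i + 1) (len - 1) := Dd_split col (by omega)
    have h2 : Dd col (i + 1) (len - 1) =
        Dd col (i + 1) (len - 2) + Dd col (i + 1 + (len - 2)) (len - 1 - (len - 2)) :=
      Dd_split col (by omega)
    have h3 : len - 1 - (len - 2) = 1 := by omega
    have h4 : i + 1 + (len - 2) < N := by omega
    rw [h3, Dd_one col h4] at h2
    have hfin' : (⟨i + 1 + (len - 2), h4⟩ : Fin N) = ⟨i + len - 1, hj⟩ :=
      Fin.ext (by show i + 1 + (len - 2) = i + len - 1; omega)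
    rw [hfin'] at h2
    rw [Dd_one col hi] at h1
    rw [h1, h2, hopp] at hbal
    linarith

end Balanced

end Literature.Barriers.ValiantsHypothesis.RazYehudayoff
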